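import Summits.BirchSwinnertonDyer.Rank1Residual.P2.CongruentNumberThetaFourPrimesSelmerCfg
import HarnessLib

/-!
# Cell `bsd-monsky` (prover-B): `BSD(E_n, 2)` AT `k = 4` — `ord_{s=1} L = 1`, rank `1`, `Ш[2^∞] = 0` and the `2`-part of BSD
# for `n = 2p₁p₂p₃p₄` of the type `(3,5,5,5)` with `g(n)` odd, relative to {`tyz_cmPointGaloisData`, TYZ Thm. 1.1, GZK,
# Aoki 1999 Thm. 2.2} (kernel theorems; nothing asserted)

HONEST FRAMING (cell `bsd-monsky`, run/shared/lean/pub/bsd-monsky/; README §1/§3): the cell's CLAIMED theorem is Monsky's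
1990 conjecture on `𝒮⁻` (`k = 2`); this file extends the README §3 RECORD «what the same argument gives at `ℓ ≥ 3`» to the
`2`-part of BSD at `k = 4` on an explicit family and books nothing.  `…ThetaFourPrimesFamily.lean` proved clause (a)
(`analyticRank_eq_one_two_mul_3555_family`: `ord_{s=1} L(E_n, s) = 1`) for `n = 2p₁p₂p₃p₄`, `p₁ ≡ 3`, `p₂ ≡ p₃ ≡ p₄ ≡ 5
(mod 8)` distinct, under «the number of pairs of `−1`-symbols among `(p₂/p₁), (p₃/p₁), (p₄/p₁), (p₃/p₂), (p₄/p₂), (p₄/p₃)`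
sharing a prime is even» (⟺ `g(n)` odd, Rédei–Reichardt — a tree theorem), from {`tyz_cmPointGaloisData`, TYZ Thm. 1.1}.
HERE, with GZK and Aoki's Theorem 2.2 (the `2`-Selmer count; `= ` Monsky's even matrix count by `…EvenAokiMonskyAllPrimes`):
* `monskySelmerRankEven_3555` — Monsky's `s(n) = 1` on the whole `g(n)`-odd part of the type (transfer of the
  configuration computation `card_ker_monskyCfgEven_3555` of `…ThetaFourPrimesSelmerCfg.lean` to the primes);
* `rankOneDatum_two_mul_3555` — the rank-one datum `L′(E_n, 1) = x·Ω·Reg`, `x = 2⁶·𝓛(n)²`, `𝓛(n)` odd, `ord₂ x = 6`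
  (TYZ (1.1) read in the tree; `twoExponent (2p₁p₂p₃p₄) = 2·4 − 2`);
* `rankOne_sha_bsdp_two_iff_congruentNumberCurve_two_mul_pqrs_of_aoki` — the uniform even door at `k = 4`, `(p, q, r, s)` form;
* `rankOne_sha_bsdp_two_two_mul_3555_family_of_aoki` — **`ord_{s=1} L = 1 ∧ rank E_n(ℚ) = 1 ∧ Ш(E_n)[2^∞] = 0 ∧ BSD(E_n, 2)`
  on the whole family**, relative to FOUR named facts {`tyz_cmPointGaloisData`, `thm11_parity_of_scriptL`, GZK,
  `thm22_card_selmerGroup_two`}.  NO statement about TYZ Thm. 1.2's `Σ₂′` at `k = 4` is made here (its configuration calculus is typed for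
  three primes; that `θ` decides SILENT cells of this type, e.g. `11310 = 2·3·5·13·29`, is the CONTROL statement of
  `…ThetaFourPrimesFamily.lean`, not a theorem).  CONDITIONAL; nothing asserted; closes no class by itself.
[cite: TianYuanZhang2017, §1 ((1.1), g(d)), Thm. 1.1, Thm. 3.5, §3] [cite: Aoki1999, Thm. 2.2 (p. 81)]
[cite: HeathBrown1994SelmerCongruentII, Appendix (Monsky), typescript p. 41 L20–L36] [cite: LiMa2008, Thm. 0.4]
[cite: Miller2011LMS, Def. 1.1 (arXiv:1010.2431 p. 3)]
-/

noncomputable section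

open scoped Classical

open Matrix Finset WeierstrassCurve Literature.NumberTheory.EllipticCurves
  Literature.NumberTheory.EllipticCurves.Rank1Residual
  Literature.NumberTheory.EllipticCurves.Rank1Residual.Typed
  Literature.NumberTheory.EllipticCurves.HeathBrown1994
  Literature.NumberTheory.EllipticCurves.Aoki1999
  Literature.NumberTheory.EllipticCurves.Tian2014
  Literature.NumberTheory.EllipticCurves.TianYuanZhang2017
  Literature.NumberTheory.EllipticCurves.TianYuanZhang2017.W2
  Literature.NumberTheory.QuadraticFields.RedeiReichardt

set_option autoImplicit false

namespace Summit.BirchSwinnertonDyer.Rank1Residual.P2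

namespace ThetaDescent

variable {p₁ p₂ p₃ p₄ : ℕ}

/-! ## §1 Monsky's `s(n) = 1` on the `g(n)`-odd part of the type, transferred to the primes -/

/-- **Monsky's `s(2p₁p₂p₃p₄) = 1` on the type `(3,5,5,5)` with an even number of pairs of `−1`-symbols sharing a prime**
(kernel-decided on the configuration, `card_ker_monskyCfgEven_3555`, transferred by `cfg_3555`).
[cite: HeathBrown1994SelmerCongruentII, Appendix (Monsky), typescript p. 41 L36] [cite: IrelandRosen1990, Ch. 5 §2 Thm. 1] -/
theorem monskySelmerRankEven_3555 (hp₁ : p₁.Prime) (hp₂ : p₂.Prime) (hp₃ : p₃.Prime) (hp₄ : p₄.Prime) (h₁ : p₁ % 8 = 3)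
    (h₂ : p₂ % 8 = 5) (h₃ : p₃ % 8 = 5) (h₄ : p₄ % 8 = 5) (h23 : p₂ ≠ p₃) (h24 : p₂ ≠ p₄) (h34 : p₃ ≠ p₄)
    (hbits : kroneckerBit p₂ p₁ * kroneckerBit p₃ p₁ + kroneckerBit p₂ p₁ * kroneckerBit p₄ p₁ +
        kroneckerBit p₂ p₁ * kroneckerBit p₃ p₂ + kroneckerBit p₂ p₁ * kroneckerBit p₄ p₂ +
        kroneckerBit p₃ p₁ * kroneckerBit p₄ p₁ + kroneckerBit p₃ p₁ * kroneckerBit p₃ p₂ + kroneckerBit p₃ p₁ * kroneckerBit p₄ p₃ +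
        kroneckerBit p₄ p₁ * kroneckerBit p₄ p₂ + kroneckerBit p₄ p₁ * kroneckerBit p₄ p₃ +
        kroneckerBit p₃ p₂ * kroneckerBit p₄ p₂ + kroneckerBit p₃ p₂ * kroneckerBit p₄ p₃ +
        kroneckerBit p₄ p₂ * kroneckerBit p₄ p₃ = 0) :
    monskySelmerRankEven ![p₁, p₂, p₃, p₄] = 1 := by
  obtain ⟨ht, ht2, hinj⟩ := quad_3555 hp₁ hp₂ hp₃ hp₄ h₁ h₂ h₃ h₄ h23 h24 h34
  obtain ⟨hR, hB⟩ := cfg_3555 hp₁ hp₂ hp₃ hp₄ h₁ h₂ h₃ h₄ h23 h24 h34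
  rw [monskySelmerRankEven_eq_one_iff_card_ker, card_ker_monskyMatrixEven_eq_cfg _ ht ht2 hinj]
  have hmat : monskyCfgEven (fun i => (![p₁, p₂, p₃, p₄] : Fin 4 → ℕ) i % 8)
      (fun a b => kroneckerBit ((![p₁, p₂, p₃, p₄] : Fin 4 → ℕ) b) ((![p₁, p₂, p₃, p₄] : Fin 4 → ℕ) a)) =
      monskyCfgEven ![3, 5, 5, 5]
        (![![0, kroneckerBit p₂ p₁, kroneckerBit p₃ p₁, kroneckerBit p₄ p₁],
            ![kroneckerBit p₂ p₁, 0, kroneckerBit p₃ p₂, kroneckerBit p₄ p₂],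
            ![kroneckerBit p₃ p₁, kroneckerBit p₃ p₂, 0, kroneckerBit p₄ p₃],
            ![kroneckerBit p₄ p₁, kroneckerBit p₄ p₂, kroneckerBit p₄ p₃, 0]] : Fin 4 → Fin 4 → ZMod 2) := by
    rw [hR, hB]
  rw [Fintype.card_congr (Equiv.subtypeEquivRight fun v => by rw [hmat])]
  exact card_ker_monskyCfgEven_3555 _ _ _ _ _ _ hbits

/-! ## §2 The rank-one datum (`ord₂ x = 6`) -/

/-- **The rank-one datum of the type `(3,5,5,5)` with `g(n)` odd**: `ord_{s=1} L(E_n, s) = 1` and `L′(E_n, 1) = x·Ω·Reg` with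
`x = 2⁶·𝓛²`, `𝓛` odd, `ord₂ x = 6` (TYZ (1.1) read in the tree; `twoExponent (2p₁p₂p₃p₄) = 2·4 − 2`). Relative to
{`tyz_cmPointGaloisData`, TYZ Thm. 1.1, GZK}; nothing asserted. [cite: TianYuanZhang2017, §1 ((1.1), p0002 L63–L75), Thm. 1.1, Thm. 3.5] -/
theorem rankOneDatum_two_mul_3555 (hCM : tyz_cmPointGaloisData) (h11 : thm11_parity_of_scriptL)
    (hGZK : rank_eq_analyticRank_of_analyticRank_le_one) (hp₁ : p₁.Prime) (hp₂ : p₂.Prime) (hp₃ : p₃.Prime)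
    (hp₄ : p₄.Prime) (h₁ : p₁ % 8 = 3) (h₂ : p₂ % 8 = 5) (h₃ : p₃ % 8 = 5) (h₄ : p₄ % 8 = 5) (h23 : p₂ ≠ p₃)
    (h24 : p₂ ≠ p₄) (h34 : p₃ ≠ p₄) (hg : Odd (gK (2 * (p₁ * p₂ * p₃ * p₄)))) :
    (congruentNumberCurve (2 * (p₁ * p₂ * p₃ * p₄))).analyticRank = 1 ∧
    ∃ x : ℚ, x ≠ 0 ∧ padicValRat 2 x = 6 ∧
      deriv (congruentNumberCurve (2 * (p₁ * p₂ * p₃ * p₄))).entireLFunction 1 =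
        (x : ℂ) * ((congruentNumberCurve (2 * (p₁ * p₂ * p₃ * p₄))).realPeriodRat : ℂ) *
          ((congruentNumberCurve (2 * (p₁ * p₂ * p₃ * p₄))).regulator : ℂ) := by
  have hsq := squarefree_two_mul_3555 hp₁ hp₂ hp₃ hp₄ h₁ h₂ h₃ h₄ h23 h24 h34
  haveI := isElliptic_congruentNumberCurve hsq.ne_zero
  have hn6 := two_mul_3555_mod_eight h₁ h₂ h₃ h₄
  obtain ⟨L, hLodd, hL⟩ :=
    exists_odd_isScriptL_two_mul_3555 hCM h11 hGZK hp₁ hp₂ hp₃ hp₄ h₁ h₂ h₃ h₄ h23 h24 h34 hg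
  have hL0' : L ≠ 0 := fun h => by simp [h] at hLodd
  have hL0 : (L : ℚ) ≠ 0 := by exact_mod_cast hL0'
  have hr1 := analyticRank_congruentNumberCurve_eq_one_of_isScriptL hsq (Or.inr (Or.inl hn6)) hL hL0'
  obtain ⟨ht, -, hinj⟩ := quad_3555 hp₁ hp₂ hp₃ hp₄ h₁ h₂ h₃ h₄ h23 h24 h34
  have hodd : ∀ i, Odd ((![p₁, p₂, p₃, p₄] : Fin 4 → ℕ) i) := fun i => by
    fin_cases i <;> exact Nat.odd_iff.mpr (by simp; omega)
  have he : twoExponent (2 * (p₁ * p₂ * p₃ * p₄)) = 6 := by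
    have h := twoExponent_two_mul_prod_eq _ ht hodd hinj
    rw [Fin.prod_univ_four] at h
    norm_num at h
    exact h
  refine ⟨hr1, (2 : ℚ) ^ twoExponent (2 * (p₁ * p₂ * p₃ * p₄)) * (L : ℚ) ^ 2,
    mul_ne_zero (zpow_ne_zero _ two_ne_zero) (pow_ne_zero _ hL0), ?_, ?_⟩
  · rw [padicValRat_two_zpow_mul_sq hLodd, he]
  · rw [← (leadingLCoeff_eq_deriv_of_analyticRank_eq_one hr1).1,
      leadingLCoeff_congruentNumberCurve_eq_of_isScriptL (Nat.pos_of_ne_zero hsq.ne_zero) hr1 hL]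
    push_cast
    ring

/-! ## §3 The even `ℓ = 4` door, `(p, q, r, s)` form, modulo {GZK, hAo} -/

/-- **THE EVEN `ℓ = 4` DOOR, `(p, q, r, s)` form, with Aoki's Theorem 2.2 as the `2`-Selmer input.** For pairwise distinct
primes `p, q, r, s` with `2pqrs ≡ 6 (mod 8)`, `monskySelmerRankEven ![p, q, r, s] = 1`, and ANY rank-one datum
`L′(E_{2pqrs}, 1) = x·Ω·Reg`, `x ≠ 0`: `ord_{s=1} L = 1`, rank `1`, `Ш[2^∞] = 0`, and `BSD(E_{2pqrs}, 2) ⟺ ord₂ x = 6`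
(the uniform door `rankOne_sha_bsdp_two_iff_congruentNumberCurve_two_mul_prod_of_aoki` at `k = 4`).
[cite: Aoki1999, Thm. 2.2 (p. 81)] [cite: Miller2011LMS, Def. 1.1 (arXiv:1010.2431 p. 3)] -/
theorem rankOne_sha_bsdp_two_iff_congruentNumberCurve_two_mul_pqrs_of_aoki
    (hGZK : rank_eq_analyticRank_of_analyticRank_le_one) (hAo : thm22_card_selmerGroup_two)
    {p q r s : ℕ} (hp : p.Prime) (hq : q.Prime) (hr : r.Prime) (hs : s.Prime) (hpq : p ≠ q) (hpr : p ≠ r)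
    (hps : p ≠ s) (hqr : q ≠ r) (hqs : q ≠ s) (hrs : r ≠ s) (h8 : 2 * (p * q * r * s) % 8 = 6)
    (hsel : monskySelmerRankEven ![p, q, r, s] = 1) {x : ℚ} (hx0 : x ≠ 0)
    (hx : deriv (congruentNumberCurve (2 * (p * q * r * s))).entireLFunction 1 =
      (x : ℂ) * ((congruentNumberCurve (2 * (p * q * r * s))).realPeriodRat : ℂ) *
        ((congruentNumberCurve (2 * (p * q * r * s))).regulator : ℂ)) :
    (congruentNumberCurve (2 * (p * q * r * s))).analyticRank = 1 ∧
      (congruentNumberCurve (2 * (p * q * r * s))).mordellWeilRank = 1 ∧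
      AddCommGroup.primaryComponent (congruentNumberCurve (2 * (p * q * r * s))).sha 2 = ⊥ ∧
      (BSDp (congruentNumberCurve (2 * (p * q * r * s))) 2 ↔ padicValRat 2 x = 6) := by
  have ht : ∀ i, (![p, q, r, s] i).Prime := fun i => by fin_cases i <;> assumption
  have hinj : Function.Injective ![p, q, r, s] := by
    intro i j h
    fin_cases i <;> fin_cases j <;> simp_all
  have hn : 2 * ∏ i, ![p, q, r, s] i = 2 * (p * q * r * s) := by rw [Fin.prod_univ_four]; rfl
  obtain ⟨h1, h2, h3, h4⟩ :=
    rankOne_sha_bsdp_two_iff_congruentNumberCurve_two_mul_prod_of_aoki ![p, q, r, s] hGZK hAo ht hinj hn h8 hsel hx0 hx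
  refine ⟨h1, h2, h3, ?_⟩
  rw [h4]
  norm_num

/-! ## §4 `BSD(E_n, 2)` on the `k = 4` family -/

/-- **`BSD(E_n, 2)` AT `k = 4` on the explicit family — `ord_{s=1} L = 1`, rank `1`, `Ш[2^∞] = 0`, `BSD(E_n, 2)`** for
`n = 2p₁p₂p₃p₄`, distinct primes `p₁ ≡ 3`, `p₂ ≡ p₃ ≡ p₄ ≡ 5 (mod 8)` such that the number of pairs of `−1`-symbols among
`(p₂/p₁), (p₃/p₁), (p₄/p₁), (p₃/p₂), (p₄/p₂), (p₄/p₃)` sharing a prime is even (⟺ `g(n)` odd), relative to FOUR named facts: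
`tyz_cmPointGaloisData` (TYZ §3 as printed), `thm11_parity_of_scriptL` (TYZ Thm. 1.1), GZK, and Aoki 1999 Thm. 2.2 (the
`2`-Selmer count; Monsky's `s(n) = 1` itself is kernel-decided on the type, `monskySelmerRankEven_3555`). No statement
about TYZ Thm. 1.2's `Σ₂′` is made (cf. `…ThetaFourPrimesFamily.lean`). CONDITIONAL; nothing asserted; closes no class by
itself (a member of the census: `11310 = 2·3·5·13·29`).
[cite: TianYuanZhang2017, §1 (1.1), Thm. 1.1, Thm. 3.5, §3] [cite: Aoki1999, Thm. 2.2 (p. 81)]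
[cite: HeathBrown1994SelmerCongruentII, Appendix (Monsky), typescript p. 41 L20–L36] [cite: Miller2011LMS, Def. 1.1 (arXiv:1010.2431 p. 3)] -/
theorem rankOne_sha_bsdp_two_two_mul_3555_family_of_aoki (hCM : tyz_cmPointGaloisData) (h11 : thm11_parity_of_scriptL)
    (hGZK : rank_eq_analyticRank_of_analyticRank_le_one) (hAo : thm22_card_selmerGroup_two) :
    ∀ p₁ p₂ p₃ p₄ : ℕ, p₁.Prime → p₂.Prime → p₃.Prime → p₄.Prime → p₁ % 8 = 3 → p₂ % 8 = 5 → p₃ % 8 = 5 → p₄ % 8 = 5 →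
      p₂ ≠ p₃ → p₂ ≠ p₄ → p₃ ≠ p₄ →
      kroneckerBit p₂ p₁ * kroneckerBit p₃ p₁ + kroneckerBit p₂ p₁ * kroneckerBit p₄ p₁ +
        kroneckerBit p₂ p₁ * kroneckerBit p₃ p₂ + kroneckerBit p₂ p₁ * kroneckerBit p₄ p₂ +
        kroneckerBit p₃ p₁ * kroneckerBit p₄ p₁ + kroneckerBit p₃ p₁ * kroneckerBit p₃ p₂ + kroneckerBit p₃ p₁ * kroneckerBit p₄ p₃ +
        kroneckerBit p₄ p₁ * kroneckerBit p₄ p₂ + kroneckerBit p₄ p₁ * kroneckerBit p₄ p₃ +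
        kroneckerBit p₃ p₂ * kroneckerBit p₄ p₂ + kroneckerBit p₃ p₂ * kroneckerBit p₄ p₃ +
        kroneckerBit p₄ p₂ * kroneckerBit p₄ p₃ = 0 →
      (congruentNumberCurve (2 * (p₁ * p₂ * p₃ * p₄))).analyticRank = 1 ∧
        (congruentNumberCurve (2 * (p₁ * p₂ * p₃ * p₄))).mordellWeilRank = 1 ∧
        AddCommGroup.primaryComponent (congruentNumberCurve (2 * (p₁ * p₂ * p₃ * p₄))).sha 2 = ⊥ ∧
        BSDp (congruentNumberCurve (2 * (p₁ * p₂ * p₃ * p₄))) 2 := by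
  intro p₁ p₂ p₃ p₄ hp₁ hp₂ hp₃ hp₄ h₁ h₂ h₃ h₄ h23 h24 h34 hbits
  have h12 : p₁ ≠ p₂ := fun h => by omega
  have h13 : p₁ ≠ p₃ := fun h => by omega
  have h14 : p₁ ≠ p₄ := fun h => by omega
  have hn6 := two_mul_3555_mod_eight h₁ h₂ h₃ h₄
  have hg : Odd (gK (2 * (p₁ * p₂ * p₃ * p₄))) := by
    rw [← ZMod.natCast_eq_one_iff_odd, natCast_gK_two_mul_3555 hp₁ hp₂ hp₃ hp₄ h₁ h₂ h₃ h₄ h23 h24 h34, hbits, add_zero]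
  have hs := monskySelmerRankEven_3555 hp₁ hp₂ hp₃ hp₄ h₁ h₂ h₃ h₄ h23 h24 h34 hbits
  obtain ⟨-, x, hx0, hv, hx⟩ := rankOneDatum_two_mul_3555 hCM h11 hGZK hp₁ hp₂ hp₃ hp₄ h₁ h₂ h₃ h₄ h23 h24 h34 hg
  obtain ⟨hr1, hrk, hsha, hiff⟩ :=
    rankOne_sha_bsdp_two_iff_congruentNumberCurve_two_mul_pqrs_of_aoki hGZK hAo hp₁ hp₂ hp₃ hp₄ h12 h13 h14 h23 h24 h34
      hn6 hs hx0 hx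
  exact ⟨hr1, hrk, hsha, hiff.mpr hv⟩

end ThetaDescent

end Summit.BirchSwinnertonDyer.Rank1Residual.P2

end
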